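import Literature.AlgebraicGeometry.Motives.AbelianVarietyCohomologyExteriorH1
import Literature.AlgebraicGeometry.Motives.AbelianVarietyProduct
import Literature.AlgebraicGeometry.HodgeTheory.HodgeStructureOfHodgeModel
import Literature.AlgebraicGeometry.HodgeTheory.SupportedClassesRationalProofs
import Literature.AlgebraicGeometry.HodgeTheory.ClassesSupportedOnComplexification
import Literature.AlgebraicGeometry.HodgeTheory.BettiUniverseAxioms
import HarnessLib

/-!
# COR-CM model facts, exterior-algebra group: `H⁴` of a product of complex abelian varieties is
# spanned over `ℚ` by four-fold cup products of degree-one classes (model axiom M23 `Fact_H4_span`)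

HONEST FRAMING (cell pub-hodgecm2 / COR-CM): this file proves STANDARD facts about the Betti cohomology
of complex abelian varieties, on the tree's real carriers; it proves no case of the Hodge conjecture and
asserts nothing about algebraic cycles.

The stage-1 package `HodgeCMPerL` (cell pub-hodgecm) states its period / COR-CM theorems over an
abstract geometric universe `U : HodgeCM.Universe` and the record `U.ModelAxioms` of 28 named model facts
(`HodgeCM/Geometry/Facts.lean`); the MODEL universe `HodgeCM.Model.universeOf hHD hI hU h₃`
(`HodgeCM/Model/Universe.lean`) interprets `Var` by the Picard–CM index type of the tree
(`Literature.NumberTheory.Automorphic.PicardCM.Var`, codes `pms | cm | proj | prod`) with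
`Coh := bettiCohomology ∘ scheme`, `cup := BettiUniverse.cup`. Field M23 of `ModelAxioms` reads, for the
corner product `P = ((A_{Φ₀} × A_{Φ₁}) × A_{Φ₂}) × A_{Φ₃}`,

  `Submodule.span ℚ {x | ∃ a b c d : H¹(P, ℚ), x = (a ∪ b) ∪ (c ∪ d)} = ⊤` in `H⁴(P, ℚ)`

(Mumford, *Abelian Varieties* §1 (4): `Hʳ(X, ℤ) ≅ ∧ʳ H¹(X, ℤ)`; Lange–Birkenhake Cor. 1.1.19). In the
model the scheme of `P` is, BY `rfl` (`AbelianVariety.prod_X`), the underlying variety of the product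
abelian variety `((A₀.prod A₁).prod A₂).prod A₃` of the chosen realisations, so M23 for `universeOf` is the
theorem `span_quadCup_eq_top` below applied to that abelian variety (a one-line junction on the package
side; this file is scheme-level and serves any model universe built on `bettiCohomology`).

What is PROVED here (no named fact is introduced; the only deep input is the tree's THEOREM
`Motives.abelianVarietyCohomologyExteriorH1_holds` — `H•(A(ℂ); ℂ) = ⋀• H¹(A(ℂ); ℂ)`, Hopf 1941 for the
compact connected group manifold `A(ℂ)` —, which has complex coefficients because its surjectivity half
uses generalised eigenspaces of the squaring map over an algebraically closed field):

* `ofRatClass_cupPowOne` — change of coefficients `ℚ → ℂ` commutes with the iterated cup product of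
  degree-one classes `m_d(v) = v₀ ⌣ (v₁ ⌣ ⋯ (v_{d-1} ⌣ 1))` (`cupPowOne`; the cup product and the unit are
  natural in the coefficient ring, Hatcher §3.2 p. 215);
* `range_cupPowOne_subset_span_image` — for `X/ℂ` smooth projective every complex `m_d(v)` lies in the
  `ℂ`-span of the complexified RATIONAL `m_d(w)` (multilinearity; rational classes span `H¹(X(ℂ); ℂ)`,
  the tree's `span_isRationalClass_eq_top_of_isSmoothProjective_holds`, Voisin I §7.1.1);
* `span_eq_top_of_span_image_ofRatClass_eq_top` — DESCENT `ℂ → ℚ`: for `X/ℂ` smooth projective and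
  `G ⊆ Hᵏ(X(ℂ); ℚ)`, if the complexifications of `G` span `Hᵏ(X(ℂ); ℂ)` over `ℂ` then `G` spans
  `Hᵏ(X(ℂ); ℚ)` over `ℚ` (dimension count: `dim_ℂ Hᵏ(X(ℂ); ℂ) = dim_ℚ Hᵏ(X(ℂ); ℚ)`, universal
  coefficients over a field, Hatcher Thm. 3.2 / Cor. 3A.6 — the tree's
  `finrank_singularCohomology_eq_bettiNumber_of_field`, `bettiNumber_eq_of_algebra`);
* `span_range_cupPowOne_rat_eq_top` — for a complex abelian variety `A` and every `d`,
  `Hᵈ(A(ℂ); ℚ)` is spanned over `ℚ` by the `m_d(v)`, `v ∈ H¹(A(ℂ); ℚ)ᵈ` (the RATIONAL form of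
  Lange–Birkenhake Exercise 1.1.6 (7), surjectivity half);
* `cupPowOne_four`, `span_quadCup_eq_top` — `m₄(a,b,c,d) = (a ∪ b) ∪ (c ∪ d)` and the M23 shape verbatim
  in the `BettiUniverse.cup` spelling, for every complex abelian variety (in particular for any product of
  four CM abelian varieties).

Not here: injectivity `⋀ᵈ H¹(A; ℚ) ↪ Hᵈ(A; ℚ)` over `ℚ` (not needed by M23); Künneth in degree one (M21)
and the Weil-line facts M15/M16 (separate files of the same group).

## References
* [MumfordAV1970] D. Mumford, *Abelian Varieties* (1970), §1 (3)–(4).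
* [LangeBirkenhake1992] H. Lange, Ch. Birkenhake, *Complex Abelian Varieties* (1992), Lemma 1.1.17,
  Cor. 1.1.19, Exercise 1.1.6 (7).
* [HatcherAT2002] A. Hatcher, *Algebraic Topology* (2002), §3.1 Thm. 3.2 and p. 198, §3.2 p. 215,
  §3.A Cor. 3A.6.
* [VoisinHodgeI2002] C. Voisin, *Hodge Theory and Complex Algebraic Geometry I* (2002), §7.1.1.

Provenance: Literature home (family `hodge`, namespace `Literature.AlgebraicGeometry.HodgeTheory.RationalExteriorSpan`) of the Summits-side `CorCM/RationalExteriorSpan` (cell `pub-hodgecm2`, COR-CM; all its imports are `Literature/` and Mathlib), which `Literature/` may not import; theorems only, no named fact, no definition. Nothing here bears on `HC_CM`. Lane `lit-hodgefound` (Layer A3: CM types, their Kubota ranks and Galois combinatorics), seat p20.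
-/

noncomputable section

open _root_.CategoryTheory MonoidalCategory
open Literature.AlgebraicTopology.SingularHomology
open Literature.AlgebraicGeometry Literature.AlgebraicGeometry.Motives Literature.AlgebraicGeometry.HodgeTheory

namespace Literature.AlgebraicGeometry.HodgeTheory.RationalExteriorSpan

/-! ### Change of coefficients `ℚ → ℂ` and the iterated cup product of degree-one classes -/

section RingChange

variable {Y : Type} [TopologicalSpace Y]

/-- Change of coefficients `ℚ → ℂ` preserves the unit of the cohomology ring: `(1_ℚ) ⊗ 1 = 1_ℂ`
(`1` is the class of the constant cochain `1`). A local copy of the tree's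
`CharacteristicClasses.ringChange_one`, kept here to keep the import cone small. [cite: HatcherAT2002, §3.2 p. 215] -/
theorem ringChange_one_rat :
    singularCohomology.ringChange (algebraMap ℚ ℂ) Y 0 (singularCohomology.one ℚ Y) =
      singularCohomology.one ℂ Y := by
  rw [singularCohomology.one, singularCohomology.one, singularCohomology.ringChange_π]
  congr 1
  refine coFn_injective ?_
  rw [coFn_cocyclesRingChange, coFn_cocyclesMk, coFn_cocyclesMk]
  funext σ
  exact map_one (algebraMap ℚ ℂ)

/-- `ofRatClass 1 = 1`: the complexification of the unit class is the unit class. [cite: HatcherAT2002, §3.2 p. 215] -/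
theorem ofRatClass_one : ofRatClass Y 0 (singularCohomology.one ℚ Y) = singularCohomology.one ℂ Y := by
  rw [ofRatClass_eq_ringChange, ringChange_one_rat]

/-- `ofRatClass (a ∪ b) = ofRatClass a ∪ ofRatClass b`: complexification is multiplicative (the cup
product is natural in the coefficient ring). [cite: HatcherAT2002, §3.2 p. 215] -/
theorem ofRatClass_cupProduct {p q n : ℕ} (h : p + q = n) (a : singularCohomology ℚ ℚ Y p)
    (b : singularCohomology ℚ ℚ Y q) :
    ofRatClass Y n (cupProduct h a b) = cupProduct h (ofRatClass Y p a) (ofRatClass Y q b) := by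
  rw [ofRatClass_eq_ringChange, ofRatClass_eq_ringChange, ofRatClass_eq_ringChange,
    singularCohomology.ringChange_cupProduct]

/-- **Complexification commutes with the iterated cup product of degree-one classes**:
`ofRatClass (m_d(v)) = m_d(ofRatClass ∘ v)` for `v ∈ H¹(Y; ℚ)ᵈ`. [cite: HatcherAT2002, §3.2 p. 215] -/
theorem ofRatClass_cupPowOne (d : ℕ) (v : Fin d → singularCohomology ℚ ℚ Y 1) :
    ofRatClass Y d (cupPowOne ℚ Y d v) = cupPowOne ℂ Y d (fun i => ofRatClass Y 1 (v i)) := by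
  induction d with
  | zero => rw [cupPowOne_zero, cupPowOne_zero, ofRatClass_one]
  | succ d ih =>
    rw [cupPowOne_succ, cupPowOne_succ, ofRatClass_cupProduct, ih (Fin.tail v)]
    rfl

end RingChange

/-! ### Complex iterated cup products lie in the span of the complexified rational ones -/

section SmoothProjective

variable {n : ℕ} {X : SchemeOver ℂ}

/-- For `X/ℂ` smooth projective, every complex iterated cup product `m_d(v)`, `v ∈ H¹(X(ℂ); ℂ)ᵈ`, lies
in the `ℂ`-span of the complexified RATIONAL ones `ofRatClass (m_d(w))`, `w ∈ H¹(X(ℂ); ℚ)ᵈ`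
(multilinearity of `m_d`, and the rational classes span `H¹(X(ℂ); ℂ)` over `ℂ`).
[cite: VoisinHodgeI2002, §7.1.1] -/
theorem range_cupPowOne_subset_span_image (hX : IsSmoothProjective n X) (d : ℕ) :
    Set.range (cupPowOne ℂ (ComplexPoints X) d) ⊆
      Submodule.span ℂ (ofRatClass (ComplexPoints X) d '' Set.range (cupPowOne ℚ (ComplexPoints X) d)) := by
  induction d with
  | zero =>
    rintro _ ⟨v, rfl⟩
    refine Submodule.subset_span ⟨cupPowOne ℚ (ComplexPoints X) 0 Fin.elim0, ⟨_, rfl⟩, ?_⟩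
    rw [cupPowOne_zero, cupPowOne_zero, ofRatClass_one]
  | succ d ih =>
    rintro _ ⟨v, rfl⟩
    rw [cupPowOne_succ]
    -- the first factor lies in the span of the rational degree-one classes
    have h0 : v 0 ∈ Submodule.span ℂ (Set.range (ofRatClass (ComplexPoints X) 1)) := by
      have htop := span_isRationalClass_eq_top_of_isSmoothProjective_holds n X hX 1
      have hset : {c : complexBetti X 1 | IsRationalClass c} = Set.range (ofRatClass (ComplexPoints X) 1) := by
        ext c
        exact isRationalClass_iff_mem_range_ofRatClass c
      rw [← hset, htop]
      exact Submodule.mem_top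
    -- the second factor lies in the span of the complexified rational `m_d`
    have hd := ih ⟨Fin.tail v, rfl⟩
    have hmem := Submodule.apply_mem_map₂ (cupProduct (Nat.add_comm 1 d)) h0 hd
    rw [Submodule.map₂_span_span] at hmem
    refine Submodule.span_mono ?_ hmem
    rintro _ ⟨_, ⟨a, rfl⟩, _, ⟨_, ⟨u, rfl⟩, rfl⟩, rfl⟩
    refine ⟨cupPowOne ℚ (ComplexPoints X) (d + 1) (Fin.cons a u), ⟨_, rfl⟩, ?_⟩
    rw [← cupProduct_cupPowOne, ofRatClass_cupProduct]

/-- **Descent `ℂ → ℚ` for spanning sets.** For `X/ℂ` smooth projective and `G ⊆ Hᵏ(X(ℂ); ℚ)`: if the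
complexified classes `ofRatClass '' G` span `Hᵏ(X(ℂ); ℂ)` over `ℂ`, then `G` spans `Hᵏ(X(ℂ); ℚ)` over
`ℚ`. Dimension count: the `ℂ`-span of `ofRatClass '' G` is contained in the `ℂ`-span of the images of a
`ℚ`-basis of `span_ℚ G`, so `dim_ℂ Hᵏ(X(ℂ); ℂ) ≤ dim_ℚ span_ℚ G`, while `dim_ℂ Hᵏ(X(ℂ); ℂ) = dim_ℚ Hᵏ(X(ℂ); ℚ)`
(universal coefficients over a field). [cite: HatcherAT2002, §3.1 Thm. 3.2 and §3.A Cor. 3A.6] -/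
theorem span_eq_top_of_span_image_ofRatClass_eq_top (hX : IsSmoothProjective n X) (k : ℕ)
    (G : Set (bettiCohomology X k))
    (hG : Submodule.span ℂ (ofRatClass (ComplexPoints X) k '' G) = ⊤) :
    Submodule.span ℚ G = ⊤ := by
  haveI : FiniteDimensional ℚ (bettiCohomology X k) := finiteDimensional_bettiCohomology hX k
  set S : Submodule ℚ (bettiCohomology X k) := Submodule.span ℚ G with hS
  let b := Module.finBasis ℚ S
  -- every complexified element of `G` is in the `ℂ`-span of the complexified basis vectors
  have hsub : ofRatClass (ComplexPoints X) k '' G ⊆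
      (Submodule.span ℂ (Set.range fun i => ofRatClass (ComplexPoints X) k (b i : bettiCohomology X k)) :
        Set (complexBetti X k)) := by
    rintro _ ⟨g, hg, rfl⟩
    have hgS : g ∈ S := Submodule.subset_span hg
    have hrepr : (∑ i, b.repr ⟨g, hgS⟩ i • (b i : bettiCohomology X k)) = g := by
      have h := congrArg Subtype.val (b.sum_repr ⟨g, hgS⟩)
      simpa only [Submodule.coe_sum, Submodule.coe_smul] using h
    rw [← hrepr, map_sum]
    refine Submodule.sum_mem _ fun i _ => ?_
    rw [Motives.ofRatClass_smul]
    exact Submodule.smul_mem _ _ (Submodule.subset_span ⟨i, rfl⟩)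
  -- hence `dim_ℂ Hᵏ(X(ℂ); ℂ) ≤ dim_ℚ S`
  have hle : Module.finrank ℂ (complexBetti X k) ≤ Module.finrank ℚ S := by
    have h1 : Submodule.span ℂ
        (Set.range fun i => ofRatClass (ComplexPoints X) k (b i : bettiCohomology X k)) = ⊤ := by
      refine eq_top_iff.2 ?_
      rw [← hG]
      exact Submodule.span_le.2 hsub
    calc Module.finrank ℂ (complexBetti X k)
        = Module.finrank ℂ (⊤ : Submodule ℂ (complexBetti X k)) := (finrank_top ℂ (complexBetti X k)).symm
      _ = (Set.range fun i => ofRatClass (ComplexPoints X) k (b i : bettiCohomology X k)).finrank ℂ := by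
          rw [Set.finrank, h1]
      _ ≤ Fintype.card (Fin (Module.finrank ℚ S)) := finrank_range_le_card _
      _ = Module.finrank ℚ S := Fintype.card_fin _
  -- and `dim_ℂ Hᵏ(X(ℂ); ℂ) = dim_ℚ Hᵏ(X(ℂ); ℚ)`
  have heq : Module.finrank ℂ (complexBetti X k) = Module.finrank ℚ (bettiCohomology X k) := by
    change Module.finrank ℂ (singularCohomology ℂ ℂ (ComplexPoints X) k) =
      Module.finrank ℚ (singularCohomology ℚ ℚ (ComplexPoints X) k)
    rw [finrank_singularCohomology_eq_bettiNumber_of_field, finrank_singularCohomology_eq_bettiNumber_of_field,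
      bettiNumber_eq_of_algebra ℚ ℂ]
  exact Submodule.eq_top_of_finrank_eq (le_antisymm (Submodule.finrank_le S) (heq ▸ hle))

end SmoothProjective

/-! ### Abelian varieties: the rational cohomology is spanned by cup products of degree-one classes -/

section AbelianVariety

variable (A : AbelianVariety ℂ)

/-- **`Hᵈ(A(ℂ); ℚ)` is spanned over `ℚ` by the iterated cup products `m_d(v)` of rational degree-one
classes**, for every complex abelian variety `A` and every `d` — the rational form of the surjectivity
half of `H•(A(ℂ)) = ⋀• H¹(A(ℂ))` (Mumford §1 (4); Lange–Birkenhake Exercise 1.1.6 (7)), by descent from the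
tree's complex theorem `abelianVarietyCohomologyExteriorH1_holds`.
[cite: MumfordAV1970, §1 (4)] [cite: LangeBirkenhake1992, Exercise 1.1.6 (7)] -/
theorem span_range_cupPowOne_rat_eq_top (d : ℕ) :
    Submodule.span ℚ (Set.range (cupPowOne ℚ (ComplexPoints A.X) d)) = ⊤ := by
  have hX : IsSmoothProjective A.dim A.X := AbelianVariety.isSmoothProjective_holds (A := A)
  refine span_eq_top_of_span_image_ofRatClass_eq_top hX d _ (eq_top_iff.2 ?_)
  rw [← abelianVarietyCohomologyExteriorH1_holds.span_range_cupPowOne A d]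
  exact Submodule.span_le.2 (range_cupPowOne_subset_span_image hX d)

/-- `m₄(v) = (v₀ ∪ v₁) ∪ (v₂ ∪ v₃)` for rational degree-one classes (associativity and unit of the cup
product). [cite: HatcherAT2002, §3.2 p. 215] -/
theorem cupPowOne_four {Y : Type} [TopologicalSpace Y] (v : Fin 4 → singularCohomology ℚ ℚ Y 1) :
    cupPowOne ℚ Y 4 v =
      cupProduct (rfl : 2 + 2 = 4) (cupProduct (rfl : 1 + 1 = 2) (v 0) (v 1))
        (cupProduct (rfl : 1 + 1 = 2) (v 2) (v 3)) := by
  rw [cupPowOne_succ, cupPowOne_succ, cupPowOne_succ, cupPowOne_one,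
    cupProduct_assoc (rfl : 1 + 1 = 2) (rfl : 1 + 2 = 3) (rfl : 2 + 2 = 4) (rfl : 1 + 3 = 4)]
  rfl

/-- **Model axiom M23 (`Fact_H4_span`), scheme-level form.** For every complex abelian variety `A`,
`H⁴(A(ℂ); ℚ)` is spanned over `ℚ` by the classes `(a ∪ b) ∪ (c ∪ d)` with `a, b, c, d ∈ H¹(A(ℂ); ℚ)`, in the
`BettiUniverse.cup` spelling of the model universe. Applied to the product abelian variety
`((A₀.prod A₁).prod A₂).prod A₃` of four realised CM abelian varieties — whose underlying variety is the
model's corner product `P` by `AbelianVariety.prod_X` — this is field `H4_span` of `HodgeCM.Universe.ModelAxioms`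
for `HodgeCM.Model.universeOf`. [cite: MumfordAV1970, §1 (4)] [cite: LangeBirkenhake1992, Cor. 1.1.19] -/
theorem span_quadCup_eq_top :
    Submodule.span ℚ {x | ∃ a b c d : bettiCohomology A.X 1,
        x = BettiUniverse.cup A.X 2 2 (BettiUniverse.cup A.X 1 1 a b) (BettiUniverse.cup A.X 1 1 c d)} = ⊤ := by
  refine eq_top_iff.2 fun x _ => ?_
  have hx : (x : singularCohomology ℚ ℚ (ComplexPoints A.X) 4) ∈
      Submodule.span ℚ (Set.range (cupPowOne ℚ (ComplexPoints A.X) 4)) := by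
    rw [span_range_cupPowOne_rat_eq_top]
    exact Submodule.mem_top
  refine Submodule.span_mono ?_ hx
  rintro _ ⟨v, rfl⟩
  exact ⟨v 0, v 1, v 2, v 3, cupPowOne_four v⟩

/-- M23 for a product of four abelian varieties, stated on the product SCHEME `((A₀ ⊗ A₁) ⊗ A₂) ⊗ A₃`
(the model's `prod4`, left-nested binary products over `Spec ℂ`): the junction `AbelianVariety.prod_X` is
`rfl`, so this is `span_quadCup_eq_top` of the product abelian variety. [cite: MumfordAV1970, §1 (4) and §19] -/
theorem span_quadCup_eq_top_prod4 (A₀ A₁ A₂ A₃ : AbelianVariety ℂ) :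
    Submodule.span ℚ {x | ∃ a b c d : bettiCohomology (((A₀.X ⊗ A₁.X) ⊗ A₂.X) ⊗ A₃.X) 1,
        x = BettiUniverse.cup (((A₀.X ⊗ A₁.X) ⊗ A₂.X) ⊗ A₃.X) 2 2
          (BettiUniverse.cup (((A₀.X ⊗ A₁.X) ⊗ A₂.X) ⊗ A₃.X) 1 1 a b)
          (BettiUniverse.cup (((A₀.X ⊗ A₁.X) ⊗ A₂.X) ⊗ A₃.X) 1 1 c d)} = ⊤ :=
  span_quadCup_eq_top (((A₀.prod A₁).prod A₂).prod A₃)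

end AbelianVariety

end Literature.AlgebraicGeometry.HodgeTheory.RationalExteriorSpan

end
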